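import Summits.Schanuel.Schanuel.Theorems.ZilberEacBranchChartCoefficient
import Literature.Probability.LatticeModels.ClusterExpansionActivityPaths
import HarnessLib

/-!
# Arbitrary base branches, XXIV: the CLOSED FORM of the ramified chart —
# `m(s) = m′(0)·s·(1 − s^k(log(ψ(s)/θ) + τ))^{-1/k}`

HONEST FRAMING.  Cell `pub-schanuel` (Zilber's Exponential-Algebraic Closedness, case ladder;
host summit Schanuel), seat 2, gen 28.  The chart `m` of the witness construction is delivered
existentially (`exists_ramifiedChart`) with the identity `2πi·m(s)^{-k} = s^{-k} − log(ψ(s)/θ) − τ`;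
file XIV extracted `m′(0)^k = 2πi` by a limit.  Here the identity is solved in closed form:
**`chart_closed_form`** — there is `G` analytic at `0`, `G(0) = 1`,
`G(s)^k·(1 − s^k(log(ψ(s)/θ) + τ)) = 1`, with `m(s) = m′(0)·s·G(s)` near `0` (the `k`-th roots of
unity ambiguity is removed by continuity: `(m(s)/(m′(0)sG(s)))^k = 1` and `→ 1`, and a logarithm of
norm `< 2π` with `exp = 1` vanishes — `Literature.Probability.LatticeModels.eq_zero_of_exp_eq_one_of_norm_lt`, reused).  Consequently
`m(s) = m′(0)s(1 + (τ/k)s^k + O(s^{k+1}))`: the second-order germ of the chart, which is the input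
for the LOWER coefficients of the phase polynomial (`Π_{M−i} = φ_i m′(0)^{M−i}` for `i < k`,
`Π_{M−k} = m′(0)^{M−k}(φ_k + (M/k)τΦ(0))` — next generation; they decide the residue class
`k ∣ 2M`, `Re Π_M = 0` generically, e.g. even-degree hyperelliptic bases for `|θ|` off one circle).
Infrastructure; no density statement in this file.  EC(3,2) OPEN; NOT Schanuel's conjecture.
-/

noncomputable section

open Filter Topology Complex

set_option linter.dupNamespace false

namespace Summit.Schanuel.Schanuel.Theorems

/-- **Closed form of the ramified chart.**  From the chart identity
`2πi·m(s)^{-k} = s^{-k} − log(ψ(s)/θ) − τ` (`m` analytic, `m(0) = 0`, `ψ(0) = θ ≠ 0`, `k ≥ 1`):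
there is `G` analytic at `0` with `G(0) = 1`, `G(s)^k(1 − s^k(log(ψ(s)/θ) + τ)) = 1` and
`m(s) = m′(0)·s·G(s)` near `0`. [folklore] -/
theorem chart_closed_form {ψ : ℂ → ℂ} (hψ : AnalyticAt ℂ ψ 0) {θ : ℂ} (hθ0 : θ ≠ 0)
    (hψ0 : ψ 0 = θ) {τ : ℂ} {k : ℕ} (hk : 1 ≤ k) {m : ℂ → ℂ} (hman : AnalyticAt ℂ m 0)
    (hm0 : m 0 = 0)
    (hchart : ∀ᶠ s in 𝓝 (0 : ℂ), AnalyticAt ℂ ψ s ∧ ψ s ≠ 0 ∧ ψ s / θ ∈ Complex.slitPlane ∧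
        ‖Complex.log (ψ s / θ)‖ < 1 ∧
        (s ≠ 0 → m s ≠ 0 ∧
          (2 * Real.pi * I) * (m s ^ k)⁻¹ = (s ^ k)⁻¹ - Complex.log (ψ s / θ) - τ)) :
    ∃ G : ℂ → ℂ, AnalyticAt ℂ G 0 ∧ G 0 = 1 ∧
      (∀ᶠ s in 𝓝 (0 : ℂ), G s ^ k * (1 - s ^ k * (Complex.log (ψ s / θ) + τ)) = 1) ∧
      ∀ᶠ s in 𝓝 (0 : ℂ), m s = deriv m 0 * s * G s := by
  have hk0 : k ≠ 0 := by omega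
  have hkC : (k : ℂ) ≠ 0 := Nat.cast_ne_zero.2 hk0
  have h2πI : (2 * Real.pi * I : ℂ) ≠ 0 := by simp [Real.pi_ne_zero, Complex.I_ne_zero]
  -- the constant `c = m′(0)`, `c^k = 2πi`
  set c : ℂ := deriv m 0 with hc
  have hck : c ^ k = 2 * Real.pi * I := deriv_chart_pow_eq hψ hθ0 hψ0 hk hman hm0 hchart
  have hc0 : c ≠ 0 := by
    intro h0
    rw [h0, zero_pow hk0] at hck
    exact h2πI hck.symm
  -- `Λ = log(ψ/θ)`, `E = 1 − s^k(Λ + τ)`, `G = E^{-1/k}`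
  set Λ : ℂ → ℂ := fun s => Complex.log (ψ s / θ) with hΛ
  have hslit0 : ψ 0 / θ ∈ Complex.slitPlane := by
    rw [hψ0, div_self hθ0]; exact Complex.one_mem_slitPlane
  have hΛan : AnalyticAt ℂ Λ 0 := (hψ.div_const).clog hslit0
  have hΛ0 : Λ 0 = 0 := by simp [hΛ, hψ0, div_self hθ0]
  set E : ℂ → ℂ := fun s => 1 - s ^ k * (Λ s + τ) with hE
  have hEan : AnalyticAt ℂ E 0 :=
    analyticAt_const.sub ((analyticAt_id.pow k).mul (hΛan.add analyticAt_const))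
  have hE0 : E 0 = 1 := by simp [hE, zero_pow hk0]
  have hEslit : E 0 ∈ Complex.slitPlane := by rw [hE0]; exact Complex.one_mem_slitPlane
  set G : ℂ → ℂ := fun s => Complex.exp (-(1 / (k : ℂ)) * Complex.log (E s)) with hG
  have hGan : AnalyticAt ℂ G 0 := (analyticAt_const.mul (hEan.clog hEslit)).cexp
  have hG0 : G 0 = 1 := by simp [hG, hE0]
  have hGne : ∀ s, G s ≠ 0 := fun s => Complex.exp_ne_zero _
  have hEne : ∀ᶠ s in 𝓝 (0 : ℂ), E s ≠ 0 :=
    hEan.continuousAt.eventually_ne (by rw [hE0]; exact one_ne_zero)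
  -- `G^k · E = 1`
  have hGk : ∀ᶠ s in 𝓝 (0 : ℂ), G s ^ k * E s = 1 := by
    filter_upwards [hEne] with s hEs
    rw [hG, ← Complex.exp_nat_mul, ← mul_assoc,
      show (k : ℂ) * (-(1 / (k : ℂ))) = -1 by field_simp, neg_one_mul, Complex.exp_neg,
      Complex.exp_log hEs, inv_mul_cancel₀ hEs]
  refine ⟨G, hGan, hG0, ?_, ?_⟩
  · filter_upwards [hGk] with s hs
    simpa only [hE, hΛ] using hs
  -- `(m s)^k = (c s G s)^k` for small `s ≠ 0`
  have hpow : ∀ᶠ s in 𝓝[≠] (0 : ℂ), m s ^ k = (c * s * G s) ^ k ∧ m s ≠ 0 := by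
    have hch := eventually_nhdsWithin_iff.2
      (hchart.mono fun s h (hs : s ∈ ({0}ᶜ : Set ℂ)) => h.2.2.2.2 hs)
    filter_upwards [hch, nhdsWithin_le_nhds hGk, nhdsWithin_le_nhds hEne, self_mem_nhdsWithin]
      with s hs hGs hEs (hs0 : s ≠ 0)
    obtain ⟨hms, hcid⟩ := hs
    refine ⟨?_, hms⟩
    have hsk : s ^ k ≠ 0 := pow_ne_zero _ hs0
    have hmk : m s ^ k ≠ 0 := pow_ne_zero _ hms
    -- `2πi s^k = m^k E`
    have e1 : (2 * Real.pi * I) * s ^ k = m s ^ k * E s := by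
      rw [hE]
      simp only [hΛ]
      field_simp at hcid
      linear_combination hcid
    -- `(c s G)^k = c^k s^k G^k = 2πi s^k G^k = m^k E G^k = m^k`
    calc m s ^ k = m s ^ k * (G s ^ k * E s) := by rw [hGs, mul_one]
      _ = (2 * Real.pi * I) * s ^ k * G s ^ k := by rw [e1]; ring
      _ = (c * s * G s) ^ k := by rw [← hck]; ring
  -- the quotient `Q = m s / (c s G s)` tends to `1` and has `Q^k = 1`; so `Q = 1`
  have hQlim : Tendsto (fun s => m s / s / (c * G s)) (𝓝[≠] (0 : ℂ)) (𝓝 1) := by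
    have h1 := tendsto_div_of_analyticAt_zero hman hm0
    have h2 : Tendsto (fun s => c * G s) (𝓝[≠] (0 : ℂ)) (𝓝 (c * 1)) := by
      have h := hGan.continuousAt.tendsto
      rw [hG0] at h
      exact (h.mono_left nhdsWithin_le_nhds).const_mul c
    have h3 := h1.div h2 (by rw [mul_one]; exact hc0)
    rw [mul_one, ← hc, div_self hc0] at h3
    exact h3
  have hlogQ : Tendsto (fun s => (k : ℂ) * Complex.log (m s / s / (c * G s))) (𝓝[≠] (0 : ℂ))
      (𝓝 0) := by
    have h := ((continuousAt_clog Complex.one_mem_slitPlane).tendsto.comp hQlim).const_mul (k : ℂ)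
    rw [Complex.log_one, mul_zero] at h
    exact h
  have hsmall : ∀ᶠ s in 𝓝[≠] (0 : ℂ), ‖(k : ℂ) * Complex.log (m s / s / (c * G s))‖ < 2 * Real.pi := by
    have h2π : (0 : ℝ) < 2 * Real.pi := by positivity
    have := (Metric.tendsto_nhds.1 hlogQ) (2 * Real.pi) h2π
    filter_upwards [this] with s hs
    rwa [dist_zero_right] at hs
  have heq : ∀ᶠ s in 𝓝[≠] (0 : ℂ), m s = c * s * G s := by
    filter_upwards [hpow, hsmall, self_mem_nhdsWithin] with s hs hsm (hs0 : s ≠ 0)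
    obtain ⟨hpk, hms⟩ := hs
    have hden : c * s * G s ≠ 0 := mul_ne_zero (mul_ne_zero hc0 hs0) (hGne s)
    set Q : ℂ := m s / s / (c * G s) with hQ
    have hQeq : Q = m s / (c * s * G s) := by rw [hQ]; field_simp
    have hQ0 : Q ≠ 0 := by rw [hQeq]; exact div_ne_zero hms hden
    have hQk : Q ^ k = 1 := by rw [hQeq, div_pow, hpk, div_self (pow_ne_zero _ hden)]
    have hexp : Complex.exp ((k : ℂ) * Complex.log Q) = 1 := by
      rw [Complex.exp_nat_mul, Complex.exp_log hQ0, hQk]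
    have hL : (k : ℂ) * Complex.log Q = 0 :=
      Literature.Probability.LatticeModels.eq_zero_of_exp_eq_one_of_norm_lt hexp hsm
    have hL0 : Complex.log Q = 0 := by
      rcases mul_eq_zero.1 hL with h | h
      · exact absurd h hkC
      · exact h
    have hQ1 : Q = 1 := by rw [← Complex.exp_log hQ0, hL0, Complex.exp_zero]
    rw [hQeq, div_eq_one_iff_eq hden] at hQ1
    exact hQ1
  -- include `s = 0`
  refine (eventually_nhdsWithin_iff.1 heq).mono fun s hs => ?_
  by_cases hs0 : s = 0
  · rw [hs0, hm0, mul_zero, zero_mul]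
  · exact hs hs0

end Summit.Schanuel.Schanuel.Theorems

end
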